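import Literature.Analysis.FluidPDE.PeriodicTestedEquation
import Literature.Analysis.FluidPDE.PeriodicTestedSlice
import Literature.Analysis.FluidPDE.LeiZhang2011MoserLevel
import HarnessLib

/-!
# Lei–Ren–Zhang 2019, §3: the energy functional per period as an absolutely continuous function of time

Analysis/FluidPDE proofs file (theorems only, no definitions, no named facts), on the discharge
path of the named fact `Literature.Analysis.FluidPDE.leiRenZhang2019_liouville_periodic`
(Z. Lei, X. Ren, Q. S. Zhang, arXiv:1902.11229 = Math. Ann. 383 (2022), Theorem 1.1). The proof of
Lemma 3.1 (arXiv p. 7) manipulates "`∂ₜ∫Ψζ_R² dx`" ((3.3), (3.8)) and integrates the differential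
inequality (3.8) in time. In the tree (as for Lei–Zhang 2011, `LeiZhang2011.log_estimate` and
its time argument `le_threshold_or_riccati`) this is the pair of facts: the slab functional
`Y(s) = ∫_{slab} H(F(s))ψ²` satisfies `Y(s₂) − Y(s₁) = ∫_{s₁}^{s₂} R` on every
`[s₁, s₂] ⊆ [−ρ², 0]`, where `R(s)` is the slab bracket of `energy_identity_axis_periodic`
(`η ≡ 1`), AND `R` is integrable on `[−ρ², 0]` — the latter from the per-slice identity
`testedSlice_eq_bracket_periodic` and the space–time integrability of the tested equation
(`integrable_testedEquation_window`, Fubini), with no joint-in-time regularity of the drift.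

* `slab_energy_package_periodic`.

## References

* Z. Lei, X. Ren, Q. S. Zhang, arXiv:1902.11229, §3 (3.3), (3.8) and "integrating (3.10)"
  (arXiv pp. 7–8). [LeiRenZhang2019]
-/

noncomputable section

open MeasureTheory Set Function Filter Metric intervalIntegral
open _root_.Topology
open scoped InnerProductSpace RealInnerProductSpace Laplacian

namespace Literature.Analysis.FluidPDE

namespace LeiRenZhang2019

open LeiZhang2011

set_option maxHeartbeats 800000 in
/-- **The slab energy functional in time** (proof of Lemma 3.1, (3.3)/(3.8): "`∂ₜ∫Ψζ_R²dx + … =`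
the bracket", integrated). In the periodic swirl setting at radius `ρ` (data as output by
`bundle_of_periodic_swirl_setting`), for `H ∈ C²` and a `z`-independent axisymmetric cut-off
`ψ ∈ C²` (`ψ = 1` on `{r ≤ ρ'}`, `ρ' > 0`; `ψ = 0` on `{r ≥ ρ₁}`, `ρ₁ ≤ ρ`; `|ψ| ≤ C_ψ`;
`∇ψ = a x_h`): the slab bracket `R(s)` is interval-integrable on `[−ρ², 0]` and
`∫_{slab} H(F(s₂))ψ² − ∫_{slab} H(F(s₁))ψ² = ∫_{s₁}^{s₂} R(s) ds` for `−ρ² ≤ s₁ ≤ s₂ ≤ 0`. [cite: LeiRenZhang2019, §3 (3.3) and (3.8) integrated in time (arXiv pp. 7–8)] -/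
theorem slab_energy_package_periodic {P ρ ρ' ρ₁ : ℝ} (hP : 0 < P) (hρ₁ρ : ρ₁ ≤ ρ)
    {F N : ℝ → EuclideanSpace ℝ (Fin 3) → ℝ}
    {b : ℝ → EuclideanSpace ℝ (Fin 3) → EuclideanSpace ℝ (Fin 3)}
    (hF2 : ∀ s, ContDiff ℝ 2 (F s)) (hFa : ∀ s, IsAxisymmetricScalar (F s))
    (hFp : ∀ s, IsAxiallyPeriodic P (F s))
    (hb1 : ∀ s, ContDiff ℝ 1 (b s)) (hbdiv : ∀ s x, VectorCalculus.divergence (b s) x = 0)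
    (hbp : ∀ s, IsAxiallyPeriodic P (b s))
    (hN : ∀ s x, N s x =
      (Δ (F s)) x - fderiv ℝ (F s) x (b s x) - 2 / cylRadius x * fderiv ℝ (F s) x (eR x))
    (heq : ∀ᵐ x ∂(volume : Measure (EuclideanSpace ℝ (Fin 3))),
      IntervalIntegrable (fun s => N s x) volume (-ρ ^ 2) 0 ∧
        ∀ s ∈ Icc (-ρ ^ 2) 0, F s x = F (-ρ ^ 2) x + ∫ σ in (-ρ ^ 2)..s, N σ x)
    (hFc : Continuous fun p : ℝ × EuclideanSpace ℝ (Fin 3) => F p.1 p.2)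
    (hNm : AEStronglyMeasurable (fun p : ℝ × EuclideanSpace ℝ (Fin 3) => N p.1 p.2)
      ((volume.restrict (Ioc (-ρ ^ 2) 0)).prod volume))
    (hNi : Integrable (fun p : ℝ × EuclideanSpace ℝ (Fin 3) => N p.1 p.2)
      ((volume.restrict (Ioc (-ρ ^ 2) 0)).prod
        (volume.restrict {x : EuclideanSpace ℝ (Fin 3) | x 2 ∈ Icc 0 (2 * P) ∧ cylRadius x ≤ ρ})))
    {H : ℝ → ℝ} (hH : ContDiff ℝ 2 H)
    {ψ a : EuclideanSpace ℝ (Fin 3) → ℝ} (hψ : ContDiff ℝ 2 ψ) (hψa : IsAxisymmetricScalar ψ)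
    (hψz : ∀ (x : EuclideanSpace ℝ (Fin 3)) (t : ℝ), ψ (x + t • eZ) = ψ x)
    (hρ' : 0 < ρ') (hψ1 : ∀ x, cylRadius x ≤ ρ' → ψ x = 1) (hψ0 : ∀ x, ρ₁ ≤ cylRadius x → ψ x = 0)
    {Cψ : ℝ} (hψb : ∀ x, |ψ x| ≤ Cψ)
    (ha : Continuous a) (haz : ∀ (x : EuclideanSpace ℝ (Fin 3)) (t : ℝ), a (x + t • eZ) = a x)
    (hψg : ∀ x, gradient ψ x = a x • horizPart x) :
    IntervalIntegrable (fun s =>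
      -(∫ x in zSlab P 0, (deriv (deriv H) (F s x) * ‖gradient (F s) x‖ ^ 2 * ψ x ^ 2 +
          deriv H (F s x) * ⟪gradient (F s) x, gradient (fun y => ψ y ^ 2) x⟫)) +
        (∫ x in zSlab P 0, H (F s x) * ⟪b s x, gradient (fun y => ψ y ^ 2) x⟫) +
        ((∫ x in zSlab P 0, 2 / cylRadius x * (H (F s x) * fderiv ℝ (fun y => ψ y ^ 2) x (eR x))) +
          2 * radialConst₂ * (ψ 0 ^ 2 * ∫ z in (0 : ℝ)..P, H (F s (meridianPoint (0, z))))))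
      volume (-ρ ^ 2) 0 ∧
    ∀ s₁ s₂ : ℝ, -ρ ^ 2 ≤ s₁ → s₁ ≤ s₂ → s₂ ≤ 0 →
      (∫ x in zSlab P 0, H (F s₂ x) * ψ x ^ 2) - (∫ x in zSlab P 0, H (F s₁ x) * ψ x ^ 2) =
        ∫ s in s₁..s₂,
          (-(∫ x in zSlab P 0, (deriv (deriv H) (F s x) * ‖gradient (F s) x‖ ^ 2 * ψ x ^ 2 +
              deriv H (F s x) * ⟪gradient (F s) x, gradient (fun y => ψ y ^ 2) x⟫)) +
            (∫ x in zSlab P 0, H (F s x) * ⟪b s x, gradient (fun y => ψ y ^ 2) x⟫) +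
            ((∫ x in zSlab P 0, 2 / cylRadius x * (H (F s x) * fderiv ℝ (fun y => ψ y ^ 2) x (eR x))) +
              2 * radialConst₂ * (ψ 0 ^ 2 * ∫ z in (0 : ℝ)..P, H (F s (meridianPoint (0, z)))))) := by
  have hn0 : -ρ ^ 2 ≤ (0 : ℝ) := neg_nonpos.2 (sq_nonneg ρ)
  have hH1 : ContDiff ℝ 1 H := hH.of_le one_le_two
  -- the constant time weight `η ≡ 1`
  set η : ℝ → ℝ := fun _ => (1 : ℝ) with hη
  have hηC : ContDiff ℝ 1 η := contDiff_const
  have hηd : deriv η = fun _ => 0 := by funext s; simp [hη]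
  have hηc : Continuous η := continuous_const
  have hη'c : Continuous (deriv η) := by rw [hηd]; exact continuous_const
  have hηb : ∀ s, |η s| ≤ 1 := fun s => by simp [hη]
  have hη'b : ∀ s, |deriv η s| ≤ 0 := fun s => by simp [hηd]
  -- `hint` on every `(t₁, t₂] ⊆ (−ρ², 0]`
  have hint : ∀ t₁ t₂ : ℝ, -ρ ^ 2 ≤ t₁ → t₂ ≤ 0 →
      Integrable (fun p : ℝ × EuclideanSpace ℝ (Fin 3) =>
        (deriv H (F p.1 p.2) * N p.1 p.2 * η p.1 + H (F p.1 p.2) * deriv η p.1) *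
          (ψ p.2 * periodicWindow P (p.2 2)) ^ 2) ((volume.restrict (Ioc t₁ t₂)).prod volume) :=
    fun t₁ t₂ ht₁ ht₂ => integrable_testedEquation_window hP hρ₁ρ ht₁ ht₂ hFc hNm hNi hH1 hηc hη'c hηb hη'b
      hψ.continuous hψb hψ0
  -- the tested slice equals the bracket, for every `s`
  have hslice : ∀ s, ∫ x, (deriv H (F s x) * N s x * η s + H (F s x) * deriv η s) *
      (ψ x * periodicWindow P (x 2)) ^ 2 =
      -(∫ x in zSlab P 0, (deriv (deriv H) (F s x) * ‖gradient (F s) x‖ ^ 2 * ψ x ^ 2 +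
          deriv H (F s x) * ⟪gradient (F s) x, gradient (fun y => ψ y ^ 2) x⟫)) +
        (∫ x in zSlab P 0, H (F s x) * ⟪b s x, gradient (fun y => ψ y ^ 2) x⟫) +
        ((∫ x in zSlab P 0, 2 / cylRadius x * (H (F s x) * fderiv ℝ (fun y => ψ y ^ 2) x (eR x))) +
          2 * radialConst₂ * (ψ 0 ^ 2 * ∫ z in (0 : ℝ)..P, H (F s (meridianPoint (0, z))))) := by
    intro s
    rw [← testedSlice_eq_bracket_periodic hP (hF2 s) (hFa s) (hFp s) (hb1 s) (hbdiv s) (hbp s) (hN s) hH hψ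
      hψa hψz hρ' hψ1 hψ0 ha haz hψg]
    refine integral_congr_ae (ae_of_all _ fun x => ?_)
    simp only [hη, deriv_const, mul_one, mul_zero, add_zero]
  refine ⟨?_, ?_⟩
  · -- integrability of the bracket from Fubini
    have h := (hint (-ρ ^ 2) 0 le_rfl le_rfl).integral_prod_left
    rw [intervalIntegrable_iff_integrableOn_Ioc_of_le hn0]
    refine (h.congr (ae_of_all _ fun s => ?_))
    exact hslice s
  · intro s₁ s₂ h1 h12 h2
    -- rebase the integrated equation to `[s₁, s₂]`
    have heq₁₂ : ∀ᵐ x ∂(volume : Measure (EuclideanSpace ℝ (Fin 3))),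
        IntervalIntegrable (fun s => N s x) volume s₁ s₂ ∧
          ∀ s ∈ Icc s₁ s₂, F s x = F s₁ x + ∫ τ in s₁..s, N τ x := by
      filter_upwards [heq] with x hx
      obtain ⟨hi, hr⟩ := integrated_eq_rebase (Fx := fun s => F s x) (Nx := fun s => N s x) h1 (h12.trans h2)
        hx.1 hx.2
      refine ⟨hi.mono_set ?_, fun s hs => hr s ⟨hs.1, hs.2.trans h2⟩⟩
      rw [uIcc_of_le h12, uIcc_of_le (h12.trans h2)]
      exact Icc_subset_Icc le_rfl h2
    have hE := energy_identity_axis_periodic h12 hP hF2 hFa hFp hb1 hbdiv hbp hN heq₁₂ hH hψ hψa hψz hρ'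
      hψ1 hψ0 ha haz hψg hηC (hint s₁ s₂ h1 h2)
    -- the left-hand side is `Y s₂ − Y s₁`
    have hiY : ∀ s, IntegrableOn (fun x => H (F s x) * ψ x ^ 2) (zSlab P 0) volume := fun s =>
      integrableOn_zSlab_of_eq_zero_of_le_cylRadius
        ((hH.continuous.comp (hF2 s).continuous).mul (hψ.continuous.pow 2)) (ρ := ρ₁)
        (fun x hx => by simp [hψ0 x hx]) P 0
    have hL : ∫ x in zSlab P 0, (H (F s₂ x) * η s₂ - H (F s₁ x) * η s₁) * ψ x ^ 2 =
        (∫ x in zSlab P 0, H (F s₂ x) * ψ x ^ 2) - ∫ x in zSlab P 0, H (F s₁ x) * ψ x ^ 2 := by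
      rw [← integral_sub (hiY s₂) (hiY s₁)]
      refine integral_congr_ae (ae_of_all _ fun x => ?_)
      simp only [hη, mul_one]
      ring
    rw [← hL, hE]
    refine intervalIntegral.integral_congr fun s _ => ?_
    simp only [hη, deriv_const, one_mul, zero_mul, add_zero]

end LeiRenZhang2019

end Literature.Analysis.FluidPDE

end
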